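import Literature.AlgebraicGeometry.HodgeTheory.HodgeGenericPointsGoodAnalyticCover
import Literature.AlgebraicGeometry.HodgeTheory.GriffithsHolomorphicHodgeSubbundlesQPChartHolds
import Literature.AlgebraicGeometry.HodgeTheory.AlgebraicMonodromyMumfordTateOfQuasiProjective
import Literature.AlgebraicGeometry.Motives.HodgeNumberFamilySemicontinuity
import Literature.Analysis.Calculus.RealAnalyticZeroSetAddHaar
import Mathlib.MeasureTheory.Function.Jacobian
import Mathlib.LinearAlgebra.Complex.FiniteDimensional
import Mathlib.Topology.GDelta.Basic
import HarnessLib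

/-!
# Very general points are Hodge generic — ALMOST EVERYWHERE and off a meagre set, UNCONDITIONALLY: the non-Hodge-generic points of a
# smooth projective family with quasi-projective total space lie in a set that is MEAGRE and LEBESGUE-NULL in algebraic coordinates
# (Deligne 1972 Prop. 7.5 / André 1992 Lemma 4 in the sharp analytic form; NO Cattani–Deligne–Kaplan, no named fact)

Family `hodge`, layer `Literature/AlgebraicGeometry/HodgeTheory`. THEOREMS only (no definition, no named fact). Written by the prover seat
`hodge-nonav-19716-p2` (g12, cell `hodge-nonav`), programme «GENERIC-AE»: the route-agnostic lift of §1 of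
`Summits/HodgeConjecture/HodgeConjecture/Theorems/SignSymmetricPowersSignThreefoldPowersHodgeAlmostAll` (same seat) from the
`M`-supported hypersurface families `familyM` to ANY smooth projective family `f : 𝒳 ⟶ S` of relative dimension `n` with `𝒳`
quasi-projective over a smooth quasi-projective base `S` (smooth of relative dimension `d`).

THE CHAIN (all tree theorems): the PINNED form of Griffiths' theorem `griffiths1968_holomorphicHodgeSubbundlesQP_chart_holds`
(programme GRIFFITHS-HOLOMORPHY, prover-Bx g18 p703779 on 20241-p1 g20 p703271: holomorphic frames of the Hodge bundles along
continuations, read in the ALGEBRAIC chart `extChartAt 𝓘(ℂ, ℂᵈ) t₁` of `chartedSpaceOfCharts (ComplexPoints.algebraicChart S d)`) ⟹ the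
Good-chart countable analytic cover `exists_countable_goodAnalyticCover_not_isHodgeGenericPoint` (this seat, after prover-Ax) with
`Good ψ` := «`ψ` is `ComplexPoints.algebraicChart S d t₀` for some `t₀`» ⟹ the non-generic points lie in `MS` := the union of countably
many sets `{t ∈ W′ | g (ψ t) = 0}` (`W′` open path connected, `g` holomorphic on `ψ(W′)`, not identically zero), each nowhere dense
(⟹ `MS` MEAGRE) and each mapped into a LEBESGUE-NULL set by every `F : S(ℂ) → ℂ^T` (`#T = d`) that is differentiable in the algebraic
charts (Mityagin: the zero set of a non-trivial real-analytic function is null, `addHaar_zeroSet_eq_zero_of_analyticOnNhd_complex`; a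
differentiable map sends null sets to null sets, Mathlib `addHaar_image_eq_zero_of_differentiableOn_of_addHaar_eq_zero`).

* `volume_image_inter_zeroSet_eq_zero` — measure theory (same real dimension): `F '' ({z ∈ U | g z = 0})` is null for `F : ℂᵈ → ℂ^T`
  differentiable on the open connected `U`, `g` real-analytic on `U` and non-zero somewhere.
* `exists_nullMeagre_isHodgeGenericPoint` — **MAIN**: `∃ MS ⊆ S(ℂ)`, meagre, with `volume (F '' MS) = 0` for every `F : S(ℂ) → ℂ^T`
  (`#T = d`) differentiable in every algebraic chart, NULL IN EVERY ALGEBRAIC CHART (`volume (c₁ '' (MS ∩ c₁.source)) = 0`), such that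
  every point off `MS` is Hodge generic (`IsHodgeGenericPoint`).
* `exists_nullMeagre_algebraicMonodromyGroup_subset_mumfordTateGroup` — with the base irreducible: off the same kind of set a
  finite-index subgroup of the monodromy group `Γ_s` and `Mon_s = (Γ_s^Zar)⁰ = glIdentityComponent (ratMonodromyGroup …)` lie in
  `MT(Hᵏ(X_s))` (Deligne (i) PROVED: `deligne_finiteIndex_monodromy_le_mumfordTateGroup_of_isQuasiProjectiveOver`).

Consumers: any «almost every member» reading of a route whose family has a coordinate map to `ℂ^d` holomorphic in algebraic charts —
route B's `SignSymmetricPowersSignThreefoldPowersHodgeAlmostAll` (coefficient chart of `S_M`, GAGA), route A's `…CyclicSurfacePowersHodgeAlmostAll`,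
and the families of routes to come (`Q8SymplecticPowers`). Honest scope: the exceptional set is NOT shown to lie in a countable union of
proper Zariski-closed subsets (Cattani–Deligne–Kaplan, print input stmt-HodgeConjecture-23152); nothing here says HC or any rung is proved.

## References

* [Deligne1972WeilK3] P. Deligne, La conjecture de Weil pour les surfaces K3, Invent. Math. 15 (1972), Prop. 7.5.
* [Andre1992] Y. André, Mumford–Tate groups of mixed Hodge structures …, Compositio Math. 82 (1992), §4 Lemma 4.
* [VoisinHodgeII2003] C. Voisin, Hodge Theory and Complex Algebraic Geometry II (2003), §5.3.1 Lemma 5.13.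
* [VoisinHodgeI2002] C. Voisin, Hodge Theory and Complex Algebraic Geometry I, CUP (2002), §10.2.1 Thm. 10.3.
* [CarlsonMullerStachPeters2017] J. Carlson, S. Müller-Stach, C. Peters, Period Mappings and Period Domains, Def. 15.3.5, L.-D. 15.3.7.
* [SerreGAGA1956] J.-P. Serre, Géométrie algébrique et géométrie analytique, §2 n°5 Prop. 2.
* [Mityagin2015] B. Mityagin, The zero set of a real analytic function, arXiv:1512.07276, Prop. 1.
-/

noncomputable section

open scoped Manifold ContDiff Topology TensorProduct
open MeasureTheory Set Module
open CategoryTheory AlgebraicGeometry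
open _root_.Topology _root_.Filter
open Literature.AlgebraicTopology.SingularHomology
open Literature.AlgebraicGeometry.Motives Literature.NumberTheory.Transcendental

namespace Literature.AlgebraicGeometry.HodgeTheory

section HodgeTheory

/-! ### Measure theory: differentiable images of analytic zero sets are null -/

/-- **A differentiable image of the zero set of a non-trivial real-analytic function is Lebesgue-null** (target of the same real
dimension): for `U ⊆ ℂᵈ` open and connected, `g : ℂᵈ → ℂ` real-analytic on `U` with `g z ≠ 0` for some `z ∈ U`, and `F : ℂᵈ → ℂ^T`
(`#T = d`) differentiable on `U`, `volume (F '' {z ∈ U | g z = 0}) = 0` (Mityagin's theorem for the additive Haar measure `L_* vol`,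
`L : ℂ^T ≃ ℂᵈ` real-linear, then Mathlib's `addHaar_image_eq_zero_of_differentiableOn_of_addHaar_eq_zero`; the argument of route A's
`CyclicUnitaryPowersGenericCyclicSurfacePowersHodge.volume_image_zeroSet_eq_zero`, restated at Literature level).
[cite: Mityagin2015, Proposition 1] -/
theorem volume_image_inter_zeroSet_eq_zero {d : ℕ} {T : Type} [Fintype T]
    (hcard : Fintype.card T = d) {U : Set (Fin d → ℂ)} (hU : IsOpen U) (hUc : IsConnected U)
    {g : (Fin d → ℂ) → ℂ} (hg : AnalyticOnNhd ℝ g U) (hne : ∃ z ∈ U, g z ≠ 0)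
    {F : (Fin d → ℂ) → (T → ℂ)} (hF : DifferentiableOn ℝ F U) :
    volume (F '' {z ∈ U | g z = 0}) = 0 := by
  have hfin : Module.finrank ℝ (T → ℂ) = Module.finrank ℝ (Fin d → ℂ) := by
    rw [finrank_real_of_complex, finrank_real_of_complex, Module.finrank_fintype_fun_eq_card,
      Module.finrank_fintype_fun_eq_card, Fintype.card_fin, hcard]
  let L : (T → ℂ) ≃L[ℝ] (Fin d → ℂ) := ContinuousLinearEquiv.ofFinrankEq hfin
  let η : Measure (Fin d → ℂ) := Measure.map L volume
  haveI : η.IsAddHaarMeasure := L.isAddHaarMeasure_map _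
  have hA : η {z ∈ U | g z = 0} = 0 :=
    Literature.Analysis.Calculus.addHaar_zeroSet_eq_zero_of_analyticOnNhd_complex η hU hUc hg hne
  have hLF : DifferentiableOn ℝ (L ∘ F) {z ∈ U | g z = 0} :=
    (L.differentiable.comp_differentiableOn hF).mono fun z hz ↦ hz.1
  have hB : η ((L ∘ F) '' {z ∈ U | g z = 0}) = 0 :=
    addHaar_image_eq_zero_of_differentiableOn_of_addHaar_eq_zero η hLF hA
  have hset : F '' {z ∈ U | g z = 0} = L ⁻¹' ((L ∘ F) '' {z ∈ U | g z = 0}) := by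
    rw [Set.image_comp, L.injective.preimage_image]
  have hmap : η ((L ∘ F) '' {z ∈ U | g z = 0}) = volume (L ⁻¹' ((L ∘ F) '' {z ∈ U | g z = 0})) := by
    have h := L.toHomeomorph.toMeasurableEquiv.map_apply (μ := volume) ((L ∘ F) '' {z ∈ U | g z = 0})
    simp only [Homeomorph.toMeasurableEquiv_coe, ContinuousLinearEquiv.coe_toHomeomorph] at h
    exact h
  rw [hset, ← hmap]
  exact hB

/-! ### The non-Hodge-generic points are meagre and null in algebraic coordinates — unconditional -/

/-- **Very general points are Hodge generic, almost everywhere and off a meagre set — UNCONDITIONAL** (Deligne 1972 Prop. 7.5 ∕ André 1992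
Lemma 4, sharp analytic form).  For a smooth projective family `f : 𝒳 ⟶ S` of relative dimension `n` with `𝒳` quasi-projective over a smooth
quasi-projective base `S`, smooth of relative dimension `d`, cohomologically locally trivial (`hU`), Hodge-symmetric models `A t` and a degree
`k`: there is `MS ⊆ S(ℂ)`, MEAGRE, such that `volume (F '' MS) = 0` for EVERY `F : S(ℂ) → ℂ^T` (`#T = d`) differentiable (over `ℝ`) in every
algebraic chart of `S(ℂ)`, such that `MS` is NULL IN EVERY ALGEBRAIC CHART (`volume (c₁ '' (MS ∩ c₁.source)) = 0`, `c₁` the algebraic chart at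
any `t₁`: the intrinsic Lebesgue-null notion on the complex manifold `S(ℂ)`; transition maps are smooth, `contDiffOn_ext_coord_change`), and
every point off `MS` is Hodge generic.  `MS` = the union of the countable Good-chart analytic cover
`exists_countable_goodAnalyticCover_not_isHodgeGenericPoint` fed by the PINNED Griffiths theorem
`griffiths1968_holomorphicHodgeSubbundlesQP_chart_holds` (`Good ψ` := «`ψ` is the algebraic chart at some point»; the three pinning conjuncts
convert by `extChartAt_coe` ∕ `extChartAt_source` ∕ `extChartAt_coe_symm`); each cover set is nowhere dense and is mapped by `F` into a null
set (`volume_image_inter_zeroSet_eq_zero`). [cite: Deligne1972WeilK3, Prop. 7.5] [cite: Andre1992, §4 Lemma 4]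
[cite: VoisinHodgeII2003, §5.3.1 Lemma 5.13] [cite: VoisinHodgeI2002, §10.2.1 Thm. 10.3] [cite: Mityagin2015, Proposition 1] -/
theorem exists_nullMeagre_isHodgeGenericPoint
    [HodgeTensorFacts.{0, 0}] {𝒳 S : SchemeOver ℂ} (f : 𝒳 ⟶ S) (n k d : ℕ)
    (hf : IsSmoothProjectiveFamily f n) (hS : IsQuasiProjectiveOver S) (h𝒳 : IsQuasiProjectiveOver 𝒳)
    [AlgebraicGeometry.LocallyOfFiniteType S.hom] [AlgebraicGeometry.SmoothOfRelativeDimension d S.hom]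
    (hU : IsCohomologicallyLocallyTrivialOn f (Set.univ : Set (ComplexPoints S)))
    (A : ∀ t : ComplexPoints S, HodgeModel n (fiberOver f t)) (hA : ∀ t, (A t).IsHodgeSymmetric)
    [∀ t, Module.Finite ℚ (singularCohomology ℚ ℚ (ComplexPoints (fiberOver f t)) k)] :
    ∃ MS : Set (ComplexPoints S), IsMeagre MS ∧
      (∀ (T : Type) [Fintype T], Fintype.card T = d → ∀ F : ComplexPoints S → (T → ℂ),
        (∀ t₁ : ComplexPoints S, DifferentiableOn ℝ (F ∘ (ComplexPoints.algebraicChart S d t₁).symm)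
          (ComplexPoints.algebraicChart S d t₁).target) →
        volume (F '' MS) = 0) ∧
      (∀ t₁ : ComplexPoints S,
        volume (ComplexPoints.algebraicChart S d t₁ '' (MS ∩ (ComplexPoints.algebraicChart S d t₁).source)) = 0) ∧
      ∀ s : (Set.univ : Set (ComplexPoints S)), s.1 ∉ MS → IsHodgeGenericPoint f k hU hf A hA s := by
  classical
  -- the «Good» charts: algebraic charts at some point
  let Good : OpenPartialHomeomorph (Set.univ : Set (ComplexPoints S)) (Fin d → ℂ) → Prop := fun ψ ↦
    ∃ t₀ : ComplexPoints S, (∀ t, (ψ t : Fin d → ℂ) = ComplexPoints.algebraicChart S d t₀ t.1) ∧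
      (∀ t, t ∈ ψ.source ↔ t.1 ∈ (ComplexPoints.algebraicChart S d t₀).source) ∧
      (∀ z, ((ψ.symm z : (Set.univ : Set (ComplexPoints S))) : ComplexPoints S) =
        (ComplexPoints.algebraicChart S d t₀).symm z)
  -- the countable analytic cover of the non-generic points in Good charts, from the PINNED Griffiths theorem
  obtain ⟨𝒞, h𝒞c, h𝒞s, hcov⟩ := exists_countable_goodAnalyticCover_not_isHodgeGenericPoint f n k d hf hS hU A hA Good
    (fun s t₁ N hN ↦ by
      letI cs : ChartedSpace (Fin d → ℂ) (ComplexPoints S) :=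
        chartedSpaceOfCharts (ComplexPoints.algebraicChart S d) (ComplexPoints.mem_algebraicChart_source S d)
      obtain ⟨W, hWo, ht₁W, hWN, hWpc, ψ, hWψ, hψ₁, hψ₂, hψ₃, hfr⟩ :=
        griffiths1968_holomorphicHodgeSubbundlesQP_chart_holds f n k d hf hS h𝒳 hU A hA s t₁ N hN
      refine ⟨W, hWo, ht₁W, hWN, hWpc, ψ, ⟨t₁.1, fun t ↦ ?_, fun t ↦ ?_, fun z ↦ ?_⟩, hWψ, hfr⟩
      · rw [hψ₁ t, extChartAt_coe, modelWithCornersSelf_coe, Function.id_comp]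
        rfl
      · rw [hψ₃ t, extChartAt_source]
        exact Iff.rfl
      · rw [hψ₂ z, extChartAt_coe_symm, modelWithCornersSelf_coe_symm, Function.comp_id]
        rfl)
  refine ⟨Subtype.val '' ⋃₀ 𝒞, ?_, ?_, ?_, ?_⟩
  · -- meagre
    refine Topology.IsInducing.subtypeVal.isMeagre_image ?_
    rw [isMeagre_iff_countable_union_isNowhereDense]
    exact ⟨𝒞, fun Z hZ ↦ (h𝒞s Z hZ).2, h𝒞c, subset_rfl⟩
  · -- null images under maps differentiable in algebraic charts
    intro T _ hT F hF
    have himage : F '' (Subtype.val '' ⋃₀ 𝒞) = ⋃ Z ∈ 𝒞, F '' (Subtype.val '' Z) := by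
      rw [Set.sUnion_eq_biUnion, Set.image_iUnion₂, Set.image_iUnion₂]
    rw [himage]
    refine (measure_biUnion_null_iff h𝒞c).2 fun Z hZ ↦ ?_
    obtain ⟨⟨W', ψ, g, ⟨t₀, hψa, hψs, hψy⟩, hW'o, hW'pc, hW'ψ, hg, hne', rfl⟩, -⟩ := h𝒞s Z hZ
    set c := ComplexPoints.algebraicChart S d t₀ with hc
    -- the image lies in `(F ∘ c⁻¹) '' {z ∈ ψ(W') | g z = 0}`
    have hsub : F '' (Subtype.val '' {t | t ∈ W' ∧ g (ψ t) = 0}) ⊆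
        (fun z ↦ F (c.symm z)) '' {z ∈ ψ '' W' | g z = 0} := by
      rintro _ ⟨_, ⟨t, ht, rfl⟩, rfl⟩
      refine ⟨ψ t, ⟨Set.mem_image_of_mem _ ht.1, ht.2⟩, ?_⟩
      change F (c.symm (ψ t)) = F t.1
      rw [← hψy, ψ.left_inv (hW'ψ ht.1)]
    refine measure_mono_null hsub ?_
    have hUo : IsOpen (ψ '' W') := ψ.isOpen_image_of_subset_source hW'o hW'ψ
    have hUc : IsConnected (ψ '' W') := (hW'pc.image' (ψ.continuousOn.mono hW'ψ)).isConnected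
    have hUT : ψ '' W' ⊆ c.target := by
      rintro _ ⟨t, ht, rfl⟩
      rw [hψa t]
      exact c.map_source ((hψs t).1 (hW'ψ ht))
    have hne'' : ∃ z ∈ ψ '' W', g z ≠ 0 := by
      obtain ⟨t', ht', hne'⟩ := hne'
      exact ⟨ψ t', Set.mem_image_of_mem _ ht', hne'⟩
    exact volume_image_inter_zeroSet_eq_zero hT hUo hUc (fun z hz ↦ (hg z hz).restrictScalars) hne'' ((hF t₀).mono hUT)
  · -- null in every algebraic chart (transition maps of the algebraic atlas are smooth)
    intro t₁
    letI cs : ChartedSpace (Fin d → ℂ) (ComplexPoints S) :=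
      chartedSpaceOfCharts (ComplexPoints.algebraicChart S d) (ComplexPoints.mem_algebraicChart_source S d)
    haveI : IsManifold 𝓘(ℂ, Fin d → ℂ) ω (ComplexPoints S) := isManifold_algebraicChart S d
    set c₁ := ComplexPoints.algebraicChart S d t₁ with hc₁
    have himage : c₁ '' (Subtype.val '' ⋃₀ 𝒞 ∩ c₁.source) ⊆ ⋃ Z ∈ 𝒞, c₁ '' (Subtype.val '' Z ∩ c₁.source) := by
      rintro _ ⟨x, ⟨⟨t, ⟨Z, hZ, htZ⟩, rfl⟩, hx⟩, rfl⟩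
      exact Set.mem_biUnion hZ ⟨t.1, ⟨⟨t, htZ, rfl⟩, hx⟩, rfl⟩
    refine measure_mono_null himage ((measure_biUnion_null_iff h𝒞c).2 fun Z hZ ↦ ?_)
    obtain ⟨⟨W', ψ, g, ⟨t₀, hψa, hψs, hψy⟩, hW'o, hW'pc, hW'ψ, hg, hne', rfl⟩, -⟩ := h𝒞s Z hZ
    set c₀ := ComplexPoints.algebraicChart S d t₀ with hc₀
    -- the transition map `c₁ ∘ c₀⁻¹` is smooth on `c₀(c₀.source ∩ c₁.source)`
    have hO : ((extChartAt 𝓘(ℂ, Fin d → ℂ) t₀).symm ≫ extChartAt 𝓘(ℂ, Fin d → ℂ) t₁).source =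
        c₀.target ∩ c₀.symm ⁻¹' c₁.source := by
      rw [PartialEquiv.trans_source, PartialEquiv.symm_source, extChartAt_target, extChartAt_source,
        extChartAt_coe_symm, modelWithCornersSelf_coe_symm, Function.comp_id, ModelWithCorners.range_eq_univ,
        Set.inter_univ]
      rfl
    have htrans : DifferentiableOn ℝ (fun z ↦ c₁ (c₀.symm z)) (c₀.target ∩ c₀.symm ⁻¹' c₁.source) := by
      have h := contDiffOn_ext_coord_change (I := 𝓘(ℂ, Fin d → ℂ)) (n := ω) t₁ t₀
      rw [hO] at h
      have h' : ContDiffOn ℂ ω (fun z ↦ c₁ (c₀.symm z)) (c₀.target ∩ c₀.symm ⁻¹' c₁.source) := by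
        refine h.congr fun z _ ↦ ?_
        simp only [Function.comp_apply, extChartAt_coe, extChartAt_coe_symm, modelWithCornersSelf_coe,
          modelWithCornersSelf_coe_symm, Function.id_comp, Function.comp_id]
        rfl
      exact (h'.differentiableOn (by simp)).restrictScalars ℝ
    -- the image lies in `(c₁ ∘ c₀⁻¹) '' ({z ∈ ψ(W') | g z = 0} ∩ (c₀.target ∩ c₀⁻¹' c₁.source))`
    have hsub : c₁ '' (Subtype.val '' {t | t ∈ W' ∧ g (ψ t) = 0} ∩ c₁.source) ⊆
        (fun z ↦ c₁ (c₀.symm z)) '' ({z ∈ ψ '' W' | g z = 0} ∩ (c₀.target ∩ c₀.symm ⁻¹' c₁.source)) := by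
      rintro _ ⟨_, ⟨⟨t, ht, rfl⟩, hx⟩, rfl⟩
      have ht0 : t.1 ∈ c₀.source := (hψs t).1 (hW'ψ ht.1)
      have hz : c₀.symm (ψ t) = t.1 := by rw [hψa t, c₀.left_inv ht0]
      refine ⟨ψ t, ⟨⟨Set.mem_image_of_mem _ ht.1, ht.2⟩, ?_, ?_⟩, ?_⟩
      · rw [hψa t]; exact c₀.map_source ht0
      · change c₀.symm (ψ t) ∈ c₁.source
        rw [hz]; exact hx
      · change c₁ (c₀.symm (ψ t)) = c₁ t.1
        rw [hz]
    refine measure_mono_null hsub ?_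
    have hUo : IsOpen (ψ '' W') := ψ.isOpen_image_of_subset_source hW'o hW'ψ
    have hUc : IsConnected (ψ '' W') := (hW'pc.image' (ψ.continuousOn.mono hW'ψ)).isConnected
    have hne'' : ∃ z ∈ ψ '' W', g z ≠ 0 := by
      obtain ⟨t', ht', hne'⟩ := hne'
      exact ⟨ψ t', Set.mem_image_of_mem _ ht', hne'⟩
    have hA : volume {z ∈ ψ '' W' | g z = 0} = 0 :=
      Literature.Analysis.Calculus.addHaar_zeroSet_eq_zero_of_analyticOnNhd_complex volume hUo hUc
        (fun z hz ↦ (hg z hz).restrictScalars) hne''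
    exact addHaar_image_eq_zero_of_differentiableOn_of_addHaar_eq_zero volume
      (htrans.mono Set.inter_subset_right) (measure_mono_null Set.inter_subset_left hA)
  · -- off `MS`: Hodge generic
    intro s hs
    by_contra hng
    exact hs ⟨s, hcov hng, rfl⟩

/-- **Off a MEAGRE set which is NULL in algebraic coordinates, a finite-index subgroup of the monodromy group and the algebraic
monodromy group lie in the Mumford–Tate group — UNCONDITIONAL** (Deligne 1972 Prop. 7.5 + CMSP Lemma–Def. 15.3.7 •, sharp analytic form;
irreducible base).  Same setting as `exists_nullMeagre_isHodgeGenericPoint` with `S` irreducible: there is a meagre `MS ⊆ S(ℂ)` with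
`volume (F '' MS) = 0` for every `F : S(ℂ) → ℂ^T` (`#T = d`) differentiable in the algebraic charts, such that at every `s ∉ MS` (i) some
finite-index subgroup `Γ'` of `Γ_s = ratMonodromyGroup` lies in `MT(Hᵏ(X_s))(ℚ)` and (ii) `glIdentityComponent (ratMonodromyGroup f k hU s)
⊆ MT(Hᵏ(X_s))(ℚ)` (Deligne (i) PROVED for quasi-projective total space,
`deligne_finiteIndex_monodromy_le_mumfordTateGroup_of_isQuasiProjectiveOver`). [cite: Deligne1972WeilK3, Prop. 7.5]
[cite: CarlsonMullerStachPeters2017, Lemma–Definition 15.3.7] [cite: Andre1992, §4 Lemma 4] [cite: Mityagin2015, Proposition 1] -/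
theorem exists_nullMeagre_algebraicMonodromyGroup_subset_mumfordTateGroup
    [HodgeTensorFacts.{0, 0}] {𝒳 S : SchemeOver ℂ} (f : 𝒳 ⟶ S) (n k d : ℕ)
    (hf : IsSmoothProjectiveFamily f n) (hS : IsQuasiProjectiveOver S) (h𝒳 : IsQuasiProjectiveOver 𝒳)
    [AlgebraicGeometry.LocallyOfFiniteType S.hom] [AlgebraicGeometry.SmoothOfRelativeDimension d S.hom]
    (hirr : IrreducibleSpace S.left)
    (hU : IsCohomologicallyLocallyTrivialOn f (Set.univ : Set (ComplexPoints S)))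
    (A : ∀ t : ComplexPoints S, HodgeModel n (fiberOver f t)) (hA : ∀ t, (A t).IsHodgeSymmetric)
    [∀ t, Module.Finite ℚ (singularCohomology ℚ ℚ (ComplexPoints (fiberOver f t)) k)] :
    ∃ MS : Set (ComplexPoints S), IsMeagre MS ∧
      (∀ (T : Type) [Fintype T], Fintype.card T = d → ∀ F : ComplexPoints S → (T → ℂ),
        (∀ t₁ : ComplexPoints S, DifferentiableOn ℝ (F ∘ (ComplexPoints.algebraicChart S d t₁).symm)
          (ComplexPoints.algebraicChart S d t₁).target) →
        volume (F '' MS) = 0) ∧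
      (∀ t₁ : ComplexPoints S,
        volume (ComplexPoints.algebraicChart S d t₁ '' (MS ∩ (ComplexPoints.algebraicChart S d t₁).source)) = 0) ∧
      ∀ s : (Set.univ : Set (ComplexPoints S)), s.1 ∉ MS →
        (∃ Γ' : Subgroup (singularCohomology ℚ ℚ (ComplexPoints (fiberOver f s.1)) k ≃ₗ[ℚ]
            singularCohomology ℚ ℚ (ComplexPoints (fiberOver f s.1)) k),
          Γ' ≤ ratMonodromyGroup f k hU s ∧ (Γ'.subgroupOf (ratMonodromyGroup f k hU s)).FiniteIndex ∧
            Γ' ≤ ((A s.1).hodgeStructure (hf.isSmoothProjective s.1) (hA s.1) k).mumfordTateGroup) ∧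
        glIdentityComponent (ratMonodromyGroup f k hU s) ⊆
          ((A s.1).hodgeStructure (hf.isSmoothProjective s.1) (hA s.1) k).mumfordTateGroup := by
  obtain ⟨MS, hMS, hnull, hchart, hgen⟩ := exists_nullMeagre_isHodgeGenericPoint f n k d hf hS h𝒳 hU A hA
  have hSs : Smooth S.hom := AlgebraicGeometry.SmoothOfRelativeDimension.smooth d _
  exact ⟨MS, hMS, hnull, hchart, fun s hs ↦ deligne_finiteIndex_monodromy_le_mumfordTateGroup_of_isQuasiProjectiveOver f n k hf
    h𝒳 hS hSs hirr hU A hA s (hgen s hs)⟩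

end HodgeTheory

end Literature.AlgebraicGeometry.HodgeTheory

end
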